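import Literature.AlgebraicGeometry.AbelianVarieties.AbelianVarietyWeilDivisorBundleDictionary
import Literature.AlgebraicGeometry.AbelianVarieties.TheoremOfTheSquareCechPic
import Literature.AlgebraicGeometry.Motives.AbelianVarietyDualQuotient
import HarnessLib

/-!
# The fibres of `a ↦ t_a^*Θ − Θ` are the cosets of `K(Θ)` (Mumford §8 Thm. 1 / Milne I Prop. 8.14 & p. 40: the
# fibres of `λ_L : A → Pic⁰(A)`, `a ↦ t_a^*L ⊗ L⁻¹`, and of `φ_Θ : A → Â = A/K(Θ)`)

Layer `Literature/AlgebraicGeometry/Motives`, namespace `Literature.AlgebraicGeometry.Motives.AbelianVariety`.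
KERNEL ONLY: theorems; no definition, no named fact, no instance, no `sorry`.  Cell `hodgecm-mathlib`,
M1PRIME-DAG J0b road (i) residual **(R1b)** over the base field (B-plan1 (g10) R27 (c), P42: road (i) runs over
`Ω = ℂ` only), consumer = the (R3a) graph argument for `DualPair.universal` on the normal-`T` stage (CENSUS-J0b §1
rows 6–7: «`Γ(ℂ)` is the graph of a function `T(ℂ) → Â(ℂ)` — uniqueness of `b` with `𝒫_b ≅ ℳ_t`»).

For an abelian variety `A` over a field `K`, a Cartier divisor `Θ` and rational points `a, a′ ∈ A(K)`, write
`D_a = t_a^*Θ − Θ` (the tree's `AbelianVariety.weilDiv Θ a`), `φ_{[Θ]}(a) = t_a^*[Θ]·[Θ]⁻¹ ∈ Ȟ¹(A, 𝒪_A^×)` (the tree's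
`AbelianVarieties.phiPic A Θ.cechClass a`), `T(a) = t_a^*𝒪(Θ) ⊗ 𝒪(Θ)⁻¹` (the slice module of [MFK94] Def. 6.2 /
★ D2 `IsLambdaOfAt`) and `K(Θ) = {x ; t_x^*Θ ∼ Θ}` (the tree's `AbelianVariety.KTheta Θ`, Mumford §6/§8).

* §1 (any field) `cechClass_weilDiv_eq_phiPic`: `[𝒪(D_a)] = φ_{[Θ]}(a)`; **`phiPic_cechClass_eq_iff_inv_mul_mem_KTheta`**:
  `φ_{[Θ]}(a) = φ_{[Θ]}(a′) ⟺ a⁻¹a′ ∈ K(Θ)` — `φ_{[Θ]}` is a homomorphism by the theorem of the square (★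
  `phiPicHom`, ★ `AbelianVariety.theoremOfTheSquare_holds`) whose kernel on points is `K(Θ)` (★
  `phiPic_cechClass_eq_one_iff_mem_KTheta`); hence the divisor form **`weilDiv_linEquiv_weilDiv_iff_inv_mul_mem_KTheta`**
  (`D_a ∼ D_{a′} ⟺ a⁻¹a′ ∈ K(Θ)`, ★ `cechClass_eq_iff_linEquiv`), its quotient spelling `…_iff_quotient_mk_eq` (same class in
  `A(K)/K(Θ)`), and the MODULE form **`nonempty_translateTensorDual_iso_iff_inv_mul_mem_KTheta`** (`T(a) ≅ T(a′) ⟺ a⁻¹a′ ∈ K(Θ)`,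
  through ★ `weilDiv_linEquiv_iff_nonempty_translateTensorDual_iso`);
* §2 (over `ℂ`, `Θ` ample, `φ_Θ : A → Â = A/K(Θ)` the tree's `phiTheta`, `Ker φ_Θ(ℂ) = K(Θ)` ★ `ker_monoidHom_phiTheta`):
  **`map_phiTheta_eq_iff_inv_mul_mem_KTheta`** (`φ_Θ(a) = φ_Θ(a′) ⟺ a⁻¹a′ ∈ K(Θ)`), `…_iff_weilDiv_linEquiv`,
  **`map_phiTheta_eq_iff_nonempty_translateTensorDual_iso`** — «two points of `Â(ℂ)` coincide iff the `Λ(𝒪(Θ))`-slices at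
  lifts are isomorphic», the uniqueness half of the graph property in (R3a) — and `map_phiTheta_eq_of_…`.

## References
* [MumfordAV1970] D. Mumford, *Abelian Varieties* (1970), §6 Cor. 4 and Definition p. 60 (`K(L)`), §8 Thm. 1 and
  the definition of `φ_L`, `Pic⁰`, `Â = A/K(L)` in characteristic `0`.
* [MilneAV2008] J. S. Milne, *Abelian Varieties* (2008), I §8 Prop. 8.14 (p. 39) and p. 40 («it equals `K(L)`»).
* [Lange2023AbelianVarietiesC] H. Lange, *Abelian Varieties over the Complex Numbers* (2023), §1.4.2, Thm. 1.3.5,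
  Prop. 1.4.6 (b).
* [MumfordFogartyKirwan1994] D. Mumford, J. Fogarty, F. Kirwan, *Geometric Invariant Theory*, 3rd ed., Ch. 6 §2
  Def. 6.2 (p. 120).
* [Hartshorne1977] R. Hartshorne, *Algebraic Geometry* (1977), III Ex. 4.5.
-/

noncomputable section

open CategoryTheory AlgebraicGeometry MonoidalCategory

universe u

namespace Literature.AlgebraicGeometry.Motives

namespace AbelianVariety

open Literature.AlgebraicGeometry.AbelianVarieties Literature.AlgebraicGeometry.Modules
open scoped MonObj

/-! ### §1 Over any field: the fibres of `a ↦ [D_a] = φ_{[Θ]}(a)` are the `K(Θ)`-cosets -/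

section AnyField

variable {K : Type u} [Field K] (A : AbelianVariety K) (Θ : CartierDivisor A.X.left)

/-- `[𝒪(−D)] = [𝒪(D)]⁻¹` in `Ȟ¹(A, 𝒪_A^×)` (`D + (−D) ∼ 0` and `D ↦ [𝒪(D)]` is additive).
[cite: MumfordAV1970, §6 (linear equivalence and the group of divisor classes)] -/
theorem cechClass_neg_eq_inv (D : CartierDivisor A.X.left) : (-D).cechClass = (D.cechClass)⁻¹ := by
  have h0 : (D + -D).cechClass = 1 := by
    rw [(CartierDivisor.cechClass_eq_iff_linEquiv _ _).2
      (CartierDivisor.LinEquiv.add_neg (CartierDivisor.LinEquiv.refl D)), CartierDivisor.cechClass_zero]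
  rw [CartierDivisor.cechClass_add] at h0
  exact eq_inv_of_mul_eq_one_right h0

/-- **`[𝒪(D_a)] = φ_{[Θ]}(a)`**: the class of the Weil divisor `D_a = t_a^*Θ − Θ` is `t_a^*[Θ]·[Θ]⁻¹`, Mumford's
`φ_L(a) = T_a^*L ⊗ L⁻¹` for `L = 𝒪(Θ)` read in `Ȟ¹(A, 𝒪_A^×)`. [cite: MumfordAV1970, §8 (definition of φ_L)]
[cite: Lange2023AbelianVarietiesC, §1.4.2] -/
theorem cechClass_weilDiv_eq_phiPic (a : A.Points K) :
    (A.weilDiv Θ a).cechClass = phiPic A Θ.cechClass a := by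
  rw [AbelianVariety.weilDiv, CartierDivisor.cechClass_add, CartierDivisor.cechClass_pullback,
    A.cechClass_neg_eq_inv, phiPic, div_eq_mul_inv]

/-- **The fibres of `φ_{[Θ]}` on points are the `K(Θ)`-cosets**: `φ_{[Θ]}(a) = φ_{[Θ]}(a′) ⟺ a⁻¹ a′ ∈ K(Θ)`
(`φ_{[Θ]}` is a homomorphism `A(K) → Ȟ¹(A, 𝒪_A^×)` by the theorem of the square — Lange §1.4.2 / Thm. 1.3.5, a
theorem of the tree — with kernel `K(Θ) = {x ; t_x^*Θ ∼ Θ}`, Mumford §8). [cite: MumfordAV1970, §8 Thm. 1 and §6 Definition (p. 60)]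
[cite: Lange2023AbelianVarietiesC, §1.4.2 and Thm. 1.3.5] -/
theorem phiPic_cechClass_eq_iff_inv_mul_mem_KTheta (a a' : A.Points K) :
    phiPic A Θ.cechClass a = phiPic A Θ.cechClass a' ↔ a⁻¹ * a' ∈ A.KTheta Θ := by
  rw [← phiPic_cechClass_eq_one_iff_mem_KTheta A Θ (a⁻¹ * a'),
    ← phiPicHom_apply A A.theoremOfTheSquare_holds, ← phiPicHom_apply A A.theoremOfTheSquare_holds,
    ← phiPicHom_apply A A.theoremOfTheSquare_holds, map_mul, map_inv, inv_mul_eq_one]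

/-- **`D_a ∼ D_{a′} ⟺ a⁻¹ a′ ∈ K(Θ)`** (Mumford §8 Thm. 1: the fibres of `a ↦ Cl(T_a^*L ⊗ L⁻¹)` are the cosets of
`K(L)`; divisor classes embed in `Ȟ¹(A, 𝒪_A^×)`, Görtz–Wedhorn I Prop. 11.21). [cite: MumfordAV1970, §8 Thm. 1]
[cite: MilneAV2008, I §8 Prop. 8.14 (p. 39)] -/
theorem weilDiv_linEquiv_weilDiv_iff_inv_mul_mem_KTheta (a a' : A.Points K) :
    (A.weilDiv Θ a).LinEquiv (A.weilDiv Θ a') ↔ a⁻¹ * a' ∈ A.KTheta Θ := by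
  rw [← CartierDivisor.cechClass_eq_iff_linEquiv, A.cechClass_weilDiv_eq_phiPic Θ, A.cechClass_weilDiv_eq_phiPic Θ,
    A.phiPic_cechClass_eq_iff_inv_mul_mem_KTheta Θ]

/-- **`D_a ∼ D_{a′}` iff `a` and `a′` have the same class in `A(K)/K(Θ)`** (the quotient spelling consumed through
★ `dualPointsEquiv : A(ℂ)/K(Θ) ≃* Â(ℂ)`). [cite: MumfordAV1970, §8 Thm. 1] [cite: MilneAV2008, I §8 (p. 40)] -/
theorem weilDiv_linEquiv_weilDiv_iff_quotient_mk_eq (a a' : A.Points K) :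
    (A.weilDiv Θ a).LinEquiv (A.weilDiv Θ a') ↔
      (QuotientGroup.mk a : A.Points K ⧸ A.KTheta Θ) = QuotientGroup.mk a' := by
  rw [A.weilDiv_linEquiv_weilDiv_iff_inv_mul_mem_KTheta Θ, QuotientGroup.eq]

/-- **Module form: `t_a^*𝒪(Θ) ⊗ 𝒪(Θ)⁻¹ ≅ t_{a′}^*𝒪(Θ) ⊗ 𝒪(Θ)⁻¹ ⟺ a⁻¹ a′ ∈ K(Θ)`** — the fibres of [MFK94]
Def. 6.2's `Λ(𝒪(Θ)) : a ↦ T_a^*L ⊗ L⁻¹` on points are the `K(Θ)`-cosets (rank-one modules are classified by their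
class, Hartshorne III Ex. 4.5; ★ `weilDiv_linEquiv_iff_nonempty_translateTensorDual_iso`).
[cite: MumfordFogartyKirwan1994, Ch. 6 §2 Definition 6.2 (p. 120)] [cite: MumfordAV1970, §8 Thm. 1] [cite: Hartshorne1977, III Ex. 4.5] -/
theorem nonempty_translateTensorDual_iso_iff_inv_mul_mem_KTheta (a a' : A.Points K) :
    Nonempty (tensorObj ((Scheme.Modules.pullback (A.translation a).left).obj (lineBundle Θ.toUnitCocycle))
          (Modules.dual (lineBundle Θ.toUnitCocycle)) ≅
        tensorObj ((Scheme.Modules.pullback (A.translation a').left).obj (lineBundle Θ.toUnitCocycle))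
          (Modules.dual (lineBundle Θ.toUnitCocycle))) ↔
      a⁻¹ * a' ∈ A.KTheta Θ := by
  rw [← weilDiv_linEquiv_iff_nonempty_translateTensorDual_iso A Θ Θ a' a,
    A.weilDiv_linEquiv_weilDiv_iff_inv_mul_mem_KTheta Θ]

end AnyField

/-! ### §2 Over `ℂ`, `Θ` ample: the fibres of `φ_Θ : A(ℂ) → Â(ℂ)` -/

section Complex

variable (A : AbelianVariety ℂ) {Θ : CartierDivisor A.X.left} (hΘ : Θ.IsAmple)

/-- **`φ_Θ(a) = φ_Θ(a′) ⟺ a⁻¹ a′ ∈ K(Θ)`** for complex points, `φ_Θ : A → Â = A/K(Θ)` the quotient isogeny (Milne I §8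
p. 40: «the kernel … equals `K(L)`»; ★ `ker_monoidHom_phiTheta`). [cite: MilneAV2008, I §8 (p. 40)]
[cite: MumfordAV1970, §8 (the dual abelian variety in characteristic 0)] -/
theorem map_phiTheta_eq_iff_inv_mul_mem_KTheta (a a' : A.Points ℂ) :
    AlgPoints.map (A.phiTheta Θ hΘ).hom.hom.hom a = AlgPoints.map (A.phiTheta Θ hΘ).hom.hom.hom a' ↔
      a⁻¹ * a' ∈ A.KTheta Θ := by
  rw [← A.ker_monoidHom_phiTheta hΘ, MonoidHom.mem_ker, map_mul, map_inv, inv_mul_eq_one]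
  rfl

/-- **`φ_Θ(a) = φ_Θ(a′) ⟺ D_a ∼ D_{a′}`** (Mumford §8 Thm. 1 read through `Â = A/K(Θ)`).
[cite: MumfordAV1970, §8 Thm. 1] [cite: MilneAV2008, I §8 Prop. 8.14 and p. 40] -/
theorem map_phiTheta_eq_iff_weilDiv_linEquiv (a a' : A.Points ℂ) :
    AlgPoints.map (A.phiTheta Θ hΘ).hom.hom.hom a = AlgPoints.map (A.phiTheta Θ hΘ).hom.hom.hom a' ↔
      (A.weilDiv Θ a).LinEquiv (A.weilDiv Θ a') := by
  rw [A.map_phiTheta_eq_iff_inv_mul_mem_KTheta hΘ, A.weilDiv_linEquiv_weilDiv_iff_inv_mul_mem_KTheta Θ]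

/-- **`φ_Θ(a) = φ_Θ(a′) ⟺ t_a^*𝒪(Θ) ⊗ 𝒪(Θ)⁻¹ ≅ t_{a′}^*𝒪(Θ) ⊗ 𝒪(Θ)⁻¹`**: two points of `Â(ℂ) = φ_Θ(A(ℂ))` coincide iff
the `Λ(𝒪(Θ))`-slices at their lifts are isomorphic — the uniqueness half of the graph property «`Γ(ℂ)` is the graph of
a function `T(ℂ) → Â(ℂ)`» in the seesaw/ZMT proof of the universal property of `(Â, 𝒫)` (Milne I §8, Mumford §8).
[cite: MilneAV2008, I §8 Prop. 8.14 and p. 40] [cite: MumfordFogartyKirwan1994, Ch. 6 §2 Definition 6.2 (p. 120)]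
[cite: Hartshorne1977, III Ex. 4.5] -/
theorem map_phiTheta_eq_iff_nonempty_translateTensorDual_iso (a a' : A.Points ℂ) :
    AlgPoints.map (A.phiTheta Θ hΘ).hom.hom.hom a = AlgPoints.map (A.phiTheta Θ hΘ).hom.hom.hom a' ↔
      Nonempty (tensorObj ((Scheme.Modules.pullback (A.translation a).left).obj (lineBundle Θ.toUnitCocycle))
          (Modules.dual (lineBundle Θ.toUnitCocycle)) ≅
        tensorObj ((Scheme.Modules.pullback (A.translation a').left).obj (lineBundle Θ.toUnitCocycle))
          (Modules.dual (lineBundle Θ.toUnitCocycle))) := by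
  rw [A.map_phiTheta_eq_iff_inv_mul_mem_KTheta hΘ, A.nonempty_translateTensorDual_iso_iff_inv_mul_mem_KTheta Θ]

/-- **Isomorphic `Λ(𝒪(Θ))`-slices force the same point of `Â(ℂ)`** (the form the graph-injectivity step consumes).
[cite: MilneAV2008, I §8 Prop. 8.14 and p. 40] [cite: MumfordAV1970, §8 Thm. 1] -/
theorem map_phiTheta_eq_of_nonempty_translateTensorDual_iso {a a' : A.Points ℂ}
    (h : Nonempty (tensorObj ((Scheme.Modules.pullback (A.translation a).left).obj (lineBundle Θ.toUnitCocycle))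
          (Modules.dual (lineBundle Θ.toUnitCocycle)) ≅
        tensorObj ((Scheme.Modules.pullback (A.translation a').left).obj (lineBundle Θ.toUnitCocycle))
          (Modules.dual (lineBundle Θ.toUnitCocycle)))) :
    AlgPoints.map (A.phiTheta Θ hΘ).hom.hom.hom a = AlgPoints.map (A.phiTheta Θ hΘ).hom.hom.hom a' :=
  (A.map_phiTheta_eq_iff_nonempty_translateTensorDual_iso hΘ a a').2 h

/-- **Every point of `Â(ℂ)` is a `φ_Θ(a)`** (Milne I Prop. 8.14 «`λ_L` maps `A` onto `Pic⁰(A)`»; here `Â = A/K(Θ)` by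
construction, ★ `surjective_monoidHom_phiTheta` in the `AlgPoints.map` spelling). [cite: MilneAV2008, I §8 Prop. 8.14 (p. 39)] -/
theorem exists_map_phiTheta_eq (b : (A.dualOf Θ hΘ).Points ℂ) :
    ∃ a : A.Points ℂ, AlgPoints.map (A.phiTheta Θ hΘ).hom.hom.hom a = b := by
  obtain ⟨a, ha⟩ := A.surjective_monoidHom_phiTheta hΘ b
  exact ⟨a, ha⟩

end Complex

end AbelianVariety

end Literature.AlgebraicGeometry.Motives

end
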